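import Summits.FinalStateConjecture.FinalStateConjecture.Theses.EternalPapapetrou

/-!
# Route EternalPapapetrou — `JostDecayLemma` (item stmt-FinalStateConjecture-10040)

Pure real analysis, proved in full: there are no decaying solutions of
`ψ″ = (V − λ²) ψ` on a half-line `(a, ∞)` when `λ ≠ 0` and `V` is continuous and integrable there.

Proof (energy / Grönwall). With `E = ψ′² + λ²ψ²` one has `E′ = 2Vψψ′`, hence
`|E′| ≤ |V| E / |λ|` (AM–GM); so `r ↦ E(r) · exp((∫_{r₀}^r |V|)/|λ|)` is non-decreasing on
`(a, ∞)` and `E(r) ≥ E(r₀) · exp(−‖V‖_{L¹(a,∞)}/|λ|)` for `r ≥ r₀ > a`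
(`jost_energy_lower_bound`). If `ψ(r₀) ≠ 0` this is a positive uniform lower bound `c`; but
`ψ → 0` makes `(4 + λ²)ψ² < c/2` eventually, and the mean value theorem on `[R, R+1]` produces
`ξ` with `ψ′(ξ) = ψ(R+1) − ψ(R)`, whence `E(ξ) < c` — a contradiction (`JostDecayLemma_proof`).

This is the classical absence of positive-energy decaying (Jost-side) solutions for `L¹`
potentials (cf. T. Kato, Comm. Pure Appl. Math. 12 (1959); Reed–Simon IV, Thm XIII.56); the
argument here is elementary and self-contained.
-/

open MeasureTheory Set Filter Topology

-- the doubled `FinalStateConjecture` path component is the summit/problem naming scheme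
set_option linter.dupNamespace false

namespace Summit.FinalStateConjecture.FinalStateConjecture.Theorems

/-- **Algebraic heart of the Grönwall step.** For real `v, p, q` and `λ ≠ 0`,
`0 ≤ 2·v·p·q + (q² + λ²p²)·|v|/|λ|` (AM–GM after the sign split on `v`): with `p = ψ`,
`q = ψ′`, `v = V` this says `E′ + E|V|/|λ| ≥ 0` for the energy `E = ψ′² + λ²ψ²`. [folklore] -/
theorem jost_energy_deriv_bound (v p q lam : ℝ) (hlam : lam ≠ 0) :
    0 ≤ 2 * v * p * q + (q ^ 2 + lam ^ 2 * p ^ 2) * (|v| / |lam|) := by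
  have hl : 0 < |lam| := abs_pos.mpr hlam
  rw [← mul_nonneg_iff_of_pos_right hl]
  have hsq : lam ^ 2 = |lam| ^ 2 := (sq_abs lam).symm
  have key : (2 * v * p * q + (q ^ 2 + lam ^ 2 * p ^ 2) * (|v| / |lam|)) * |lam|
      = 2 * v * (|lam| * p) * q + (q ^ 2 + (|lam| * p) ^ 2) * |v| := by
    rw [hsq]
    field_simp
  rw [key]
  rcases le_total 0 v with hv | hv
  · rw [abs_of_nonneg hv]
    nlinarith [mul_nonneg hv (sq_nonneg (|lam| * p + q))]
  · rw [abs_of_nonpos hv]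
    nlinarith [mul_nonneg (neg_nonneg.mpr hv) (sq_nonneg (|lam| * p - q))]

/-- **Energy lower bound (Grönwall).** For a `C²` solution of `ψ″ = (V − λ²)ψ` on `(a, ∞)`
with `V` continuous and integrable there and `λ ≠ 0`, the energy `E = ψ′² + λ²ψ²` satisfies
`E(r) ≥ E(r₀) · exp(−(∫_{(a,∞)} |V|)/|λ|)` for all `a < r₀ ≤ r`: the weighted energy
`E(r)·exp((∫_{r₀}^r |V|)/|λ|)` has non-negative derivative by `jost_energy_deriv_bound`.
[folklore] -/
theorem jost_energy_lower_bound
    {V ψ ψ' : ℝ → ℝ} {a lam : ℝ} (hlam : lam ≠ 0) (hV : ContinuousOn V (Ioi a))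
    (hVi : IntegrableOn V (Ioi a))
    (hψ : ∀ r ∈ Ioi a, HasDerivAt ψ (ψ' r) r ∧ HasDerivAt ψ' ((V r - lam ^ 2) * ψ r) r)
    {r₀ r : ℝ} (hr₀ : a < r₀) (hr : r₀ ≤ r) :
    (ψ' r₀ ^ 2 + lam ^ 2 * ψ r₀ ^ 2) * Real.exp (-((∫ s in Ioi a, |V s|) / |lam|))
      ≤ ψ' r ^ 2 + lam ^ 2 * ψ r ^ 2 := by
  have hlam' : 0 < |lam| := abs_pos.mpr hlam
  have hVabs : ContinuousOn (fun s => |V s|) (Ioi a) := hV.abs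
  -- the primitive of `|V|` from `r₀`, the weighted energy and its derivative
  set F : ℝ → ℝ := fun x => ∫ s in r₀..x, |V s| with hF_def
  set G : ℝ → ℝ := fun x => (ψ' x ^ 2 + lam ^ 2 * ψ x ^ 2) * Real.exp (F x / |lam|) with hG_def
  set G' : ℝ → ℝ := fun x => 2 * V x * ψ x * ψ' x * Real.exp (F x / |lam|)
      + (ψ' x ^ 2 + lam ^ 2 * ψ x ^ 2) * (Real.exp (F x / |lam|) * (|V x| / |lam|)) with hG'_def
  have hG : ∀ x ∈ Ioi a, HasDerivAt G (G' x) x := by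
    intro x hx
    obtain ⟨h1, h2⟩ := hψ x hx
    have hE : HasDerivAt (fun y => ψ' y ^ 2 + lam ^ 2 * ψ y ^ 2) (2 * V x * ψ x * ψ' x) x := by
      refine ((h2.fun_pow 2).fun_add ((h1.fun_pow 2).const_mul (lam ^ 2))).congr_deriv ?_
      push_cast
      ring
    have hF : HasDerivAt F (|V x|) x := by
      apply intervalIntegral.integral_hasDerivAt_right
      · refine (hVabs.mono ?_).intervalIntegrable
        intro y hy
        exact (lt_min hr₀ hx).trans_le hy.1
      · exact hVabs.stronglyMeasurableAtFilter isOpen_Ioi x hx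
      · exact hVabs.continuousAt (isOpen_Ioi.mem_nhds hx)
    exact hE.fun_mul ((hF.div_const |lam|).exp)
  have hG'nonneg : ∀ x ∈ Ioi a, 0 ≤ G' x := by
    intro x hx
    have hfac : G' x = (2 * V x * ψ x * ψ' x
        + (ψ' x ^ 2 + lam ^ 2 * ψ x ^ 2) * (|V x| / |lam|)) * Real.exp (F x / |lam|) := by
      simp only [hG'_def]
      ring
    rw [hfac]
    exact mul_nonneg (jost_energy_deriv_bound (V x) (ψ x) (ψ' x) lam hlam) (Real.exp_pos _).le
  -- `G` is non-decreasing on `(a, ∞)`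
  have hmono : MonotoneOn G (Ioi a) := by
    apply monotoneOn_of_hasDerivWithinAt_nonneg (convex_Ioi a)
    · intro x hx
      exact (hG x hx).continuousAt.continuousWithinAt
    · intro x hx
      rw [interior_Ioi] at hx ⊢
      exact (hG x hx).hasDerivWithinAt
    · intro x hx
      rw [interior_Ioi] at hx
      exact hG'nonneg x hx
  have h1 : G r₀ ≤ G r := hmono hr₀ (hr₀.trans_le hr) hr
  -- `F r₀ = 0` and `F r ≤ ∫_{(a,∞)} |V|`
  have hFr : F r ≤ ∫ s in Ioi a, |V s| := by
    simp only [hF_def]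
    rw [intervalIntegral.integral_of_le hr]
    apply setIntegral_mono_set hVi.abs
    · exact Eventually.of_forall fun _ => abs_nonneg _
    · exact (Ioc_subset_Ioi_self.trans (Ioi_subset_Ioi hr₀.le)).eventuallyLE
  have hEr : 0 ≤ ψ' r ^ 2 + lam ^ 2 * ψ r ^ 2 := by positivity
  have h2 : G r₀ = ψ' r₀ ^ 2 + lam ^ 2 * ψ r₀ ^ 2 := by
    simp only [hG_def, hF_def, intervalIntegral.integral_same, zero_div, Real.exp_zero, mul_one]
  have h3 : G r ≤ (ψ' r ^ 2 + lam ^ 2 * ψ r ^ 2) * Real.exp ((∫ s in Ioi a, |V s|) / |lam|) := by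
    simp only [hG_def]
    apply mul_le_mul_of_nonneg_left _ hEr
    exact Real.exp_le_exp.mpr (div_le_div_of_nonneg_right hFr hlam'.le)
  have h4 : ψ' r₀ ^ 2 + lam ^ 2 * ψ r₀ ^ 2
      ≤ (ψ' r ^ 2 + lam ^ 2 * ψ r ^ 2) * Real.exp ((∫ s in Ioi a, |V s|) / |lam|) :=
    h2 ▸ h1.trans h3
  calc (ψ' r₀ ^ 2 + lam ^ 2 * ψ r₀ ^ 2) * Real.exp (-((∫ s in Ioi a, |V s|) / |lam|))
      ≤ (ψ' r ^ 2 + lam ^ 2 * ψ r ^ 2) * Real.exp ((∫ s in Ioi a, |V s|) / |lam|)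
          * Real.exp (-((∫ s in Ioi a, |V s|) / |lam|)) :=
        mul_le_mul_of_nonneg_right h4 (Real.exp_pos _).le
    _ = ψ' r ^ 2 + lam ^ 2 * ψ r ^ 2 := by
        rw [mul_assoc, ← Real.exp_add, add_neg_cancel, Real.exp_zero, mul_one]

/-- **`JostDecayLemma` (item stmt-FinalStateConjecture-10040 of route EternalPapapetrou).**
If `V` is continuous and integrable on `(a, ∞)`, `λ ≠ 0`, and `ψ` is a `C²` solution of
`ψ″ = (V − λ²) ψ` on `(a, ∞)` with `ψ(r) → 0` as `r → ∞`, then `ψ ≡ 0` on `(a, ∞)`.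
Proof: if `ψ(r₀) ≠ 0` then `jost_energy_lower_bound` bounds the energy below by some `c > 0`
on `[r₀, ∞)`, while `ψ → 0` and the mean value theorem on `[R, R+1]` give a point `ξ ≥ r₀`
with energy `< c`. [folklore] -/
theorem JostDecayLemma_proof :
    Summit.FinalStateConjecture.FinalStateConjecture.Theses.EternalPapapetrou.JostDecayLemma := by
  unfold Summit.FinalStateConjecture.FinalStateConjecture.Theses.EternalPapapetrou.JostDecayLemma
  intro V ψ ψ' a lam hlam hV hVi hψ hlim r₀ hr₀
  by_contra hne
  -- a positive uniform lower bound for the energy beyond `r₀`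
  set c : ℝ := (ψ' r₀ ^ 2 + lam ^ 2 * ψ r₀ ^ 2)
      * Real.exp (-((∫ s in Ioi a, |V s|) / |lam|)) with hc_def
  have hc : 0 < c := by
    have h1 : 0 < lam ^ 2 * ψ r₀ ^ 2 := by positivity
    have h2 : 0 < ψ' r₀ ^ 2 + lam ^ 2 * ψ r₀ ^ 2 := by positivity
    exact mul_pos h2 (Real.exp_pos _)
  have hlow : ∀ r, r₀ ≤ r → c ≤ ψ' r ^ 2 + lam ^ 2 * ψ r ^ 2 := fun r hr =>
    jost_energy_lower_bound hlam hV hVi hψ hr₀ hr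
  -- `ψ → 0`: eventually `(4 + λ²) ψ² < c/2`
  have hsmall : ∀ᶠ r in atTop, (4 + lam ^ 2) * ψ r ^ 2 < c / 2 := by
    have h1 : Tendsto (fun r => (4 + lam ^ 2) * ψ r ^ 2) atTop (𝓝 ((4 + lam ^ 2) * 0 ^ 2)) :=
      (hlim.pow 2).const_mul _
    rw [zero_pow two_ne_zero, mul_zero] at h1
    exact (tendsto_order.1 h1).2 (c / 2) (by linarith)
  obtain ⟨R₁, hR₁⟩ := Filter.eventually_atTop.1 hsmall
  set R := max R₁ r₀ with hR_def
  have hRr₀ : r₀ ≤ R := le_max_right _ _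
  have hRR₁ : R₁ ≤ R := le_max_left _ _
  have haR : a < R := lt_of_lt_of_le hr₀ hRr₀
  -- mean value theorem on `[R, R + 1]`
  have hcont : ContinuousOn ψ (Icc R (R + 1)) := by
    intro x hx
    exact (hψ x (lt_of_lt_of_le haR hx.1)).1.continuousAt.continuousWithinAt
  have hder : ∀ x ∈ Ioo R (R + 1), HasDerivAt ψ (ψ' x) x := fun x hx =>
    (hψ x (haR.trans hx.1)).1
  obtain ⟨ξ, hξ, hξ'⟩ := exists_hasDerivAt_eq_slope ψ ψ' (by linarith : R < R + 1) hcont hder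
  have hslope : ψ' ξ = ψ (R + 1) - ψ R := by
    rw [hξ', add_sub_cancel_left, div_one]
  -- the energy at `ξ` is both `≥ c` and `< c`
  have b1 := hR₁ R hRR₁
  have b2 := hR₁ (R + 1) (by linarith)
  have b3 := hR₁ ξ (by linarith [hξ.1])
  have hE := hlow ξ (by linarith [hξ.1])
  rw [hslope] at hE
  nlinarith [sq_nonneg (ψ (R + 1) + ψ R), mul_nonneg (sq_nonneg lam) (sq_nonneg (ψ R)),
    mul_nonneg (sq_nonneg lam) (sq_nonneg (ψ (R + 1))), sq_nonneg (ψ ξ)]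

end Summit.FinalStateConjecture.FinalStateConjecture.Theorems
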